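import Mathlib.Analysis.Calculus.ImplicitContDiff
import Mathlib.Analysis.Normed.Ring.Units
import Mathlib.Topology.MetricSpace.Contracting
import Literature.Analysis.Calculus.FixedPointSmoothDependence
import Literature.MathematicalPhysics.QuantumFieldTheory.Balaban1983to89.B13Contraction113

/-!
# NE9AnalyticFixedPoint — THE FIXED POINT OF A UNIFORM CONTRACTION IS JOINTLY ANALYTIC IN A BANACH PARAMETER
# (route R2 «`cur` AS A BANACH FIXED POINT» of `t4/ROUTES-NE9.md` v1, step B1 in the form step B4 needs;
# cell `pub-balaban`, T4-DAG §2 node U3 ∕ §6 NE9; unit `b2b-balaban-t4-ne9-formalise-leaf-03`, generation 37;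
# Summits-side NEW work — generic functional analysis, nothing of any import modified, nothing printed asserted)

HONEST FRAMING (T4-DAG PAGE 1).  Rung (B)+1 of the FINITE-VOLUME T⁴ programme — NOT infinite volume, NOT a mass gap, NOT
the Clay problem.  NE9 (`T4OutputRate.NE9` ∧ `FadingMemory`) is a cell NEW ESTIMATE, NOT PRINTED in [I] = CMP **109**, [II] =
CMP **116**, and NOT PROVED here («NE9 ⇐ the named binders»; spine PROVED 0∕9).  HONEST DEPENDENCY (cell line, verbatim):
continuum YM on T⁴ ⇐ BetaPertH ∧ nine spine estimates (0/9 proved); BetaPertH ⇐ (D1) ∧ (D4) ∧ CAP+tail; G-an2-4 gates asym,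
D1 and NE2/3/4.  `FlowStep.BetaPertH`, (B), (B^μ) do not occur.  Nothing of Bałaban's is constructed or discharged here.

WHY THIS FILE (route document `t4/ROUTES-NE9.md` v1 §L1.2, t4-ne9-idea-1; owner dossier `t4/ideate/NE9/00-OWNER-DOSSIER-NE9.md`
§D (D1), E109).  Route R2 proposes to make the (D1) object `cur` — the complex background family — DEFINITIONAL as the fixed point
of print's own contraction ([II] p. 5 after (1.13): *"maps the domain {X : |X| < 4C₂ε₂²} into itself and it is contractive on
this domain, hence the fixed point is an analytic function of A′, s(Y₀), bounded by 4C₂ε₂²"*), the analytic dependence on the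
parameters being a KERNEL theorem (R2-B1), and to feed the owner's T32 `NE9ComplexBackgroundOfImplicit` ∕ the substrate's
`SubstrateComplexBackground.ComplexBackgroundFamily` through the adapter R2-B4 («the IFT datum `F(ξ, X) = X − T_ξ X` has
`∂_X F = 1 − DT_ξ` with `‖DT_ξ‖ ≤ K < 1`, invertible by Neumann series»), WITH the quantitative clauses T32 disclaims
(«the implicit function theorem controls no radius»): a PRESCRIBED ball, uniqueness in it, an a-priori bound.

LOCATED STATE OF THE TREE (journal F-ne9leaf03g37-1).  ONE complex parameter at a time, R2-B1 is ALREADY KERNEL on the Literature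
side: `Balaban1983to89.B13Contraction113.differentiableOn_fixedPoint` (Part C: successive approximations + locally uniform limits)
and `analytic_fixedPoint_113` (Part D: THE (1.13) fixed point, range `4C₂ε²`, uniqueness, (1.14)), cell certificate C-B13-02 —
whose header lists as NOT CERTIFIED «joint analyticity in the several parameters … (one complex parameter at a time is typed;
separate analyticity + the uniform bounds give joint analyticity by Osgood/Hartogs — [folklore], not formalised)»; and the REAL
`Cⁿ` Banach-parameter form is `Literature.Analysis.Calculus.contDiffAt_fixedPoint` (`FixedPointSmoothDependence`, Chow–Hale §2.2).
THIS FILE closes that gap WITHOUT Osgood/Hartogs: joint analyticity of `(ξ, X) ↦ T ξ X` in a Banach parameter `ξ` and the unknown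
`X` gives joint analyticity of the fixed-point section in `ξ` — by the implicit function theorem at each parameter, glued along the
whole parameter region by uniqueness of the fixed point in the ball and continuity of the section.

WHAT (all kernel; `𝕜` = `ℝ` or `ℂ` via `RCLike`; `Ξ`, `E` complete).
* §1 (metric, any parameter type `Ξ`) `dist_le_of_fixedPt_of_lipschitzOnWith` (a-priori bound `dist x y ≤ dist (f y) y ∕ (1 − K)` for
  the fixed point `x` and any `y` of the Lipschitz set), `eq_of_fixedPt_of_lipschitzOnWith` (uniqueness), `exists_fixedPt_section`
  (a family `T ξ`, `ξ ∈ U`, of self-maps of `closedBall c r`, `K`-Lipschitz there with `K < 1`, has a fixed-point section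
  `x : Ξ → E` valued in the ball — Banach's theorem on the complete subset, `ContractingWith.exists_fixedPoint'`).
* §2 (local, `𝕜`) `norm_fderiv_comp_inr_le_of_lipschitzOnWith` (`‖∂₂T‖ ≤ K` from `K`-Lipschitz on a neighbourhood — converse
  mean value inequality `HasFDerivAt.le_of_lipschitzOn`), `contDiffAt_fixedPt` (the `𝕜`-version of the tree's real
  `contDiffAt_fixedPoint`: `T` of class `Cⁿ` at `(p, θ p)`, `‖∂₂T(p, θ p)‖ < 1`, `θ` a continuous branch of fixed points ⇒ `θ` is
  `Cⁿ` at `p`; Neumann series `Units.oneSub` + `ContDiffAt.implicitFunction` + local uniqueness).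
* §3 (global, `𝕜`) **`exists_contDiffOn_fixedPt_section`**: `U ⊆ Ξ` open, `T ξ` a self-map of `closedBall c r` for `ξ ∈ U`,
  `K`-Lipschitz (`K < 1`) on the larger OPEN ball `ball c r'` (`r < r'`), `(ξ, X) ↦ T ξ X` of class `Cⁿ` (`n ≠ 0`) on
  `U ×ˢ ball c r'` ⇒ a section `x` with `ContDiffOn 𝕜 n x U`, `x ξ ∈ closedBall c r`, `T ξ (x ξ) = x ξ`, UNIQUE in the closed
  ball, and `dist (x ξ) y ≤ dist (T ξ y) y ∕ (1 − K)` for every `y` in the closed ball (with `y = c`: the printed-type range bound).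
* §4 (`ℂ`) **`exists_analyticOnNhd_fixedPt_section`**: the same with `T` jointly ANALYTIC ⇒ `AnalyticOnNhd ℂ x U` — the form R2-B4
  consumes (parameters `(s, A′, (U,J))` jointly, any complex Banach parameter space); and `exists_differentiableOn_fixedPoint` = the
  route sketch's ONE-VARIABLE signature (`t4/ideate/NE9/lens1-NE9Lens1Sketch.lean`, `DifferentiableOn` on `U ×ˢ ball 0 r'` only,
  no `Cⁿ` hypothesis) as a COROLLARY of B13 Part C, with uniqueness and the rate `2rKⁿ∕(1 − K)` of the successive approximations.
DISGUISE TEST: Banach's fixed-point theorem, the implicit function theorem, Cauchy-type locally-uniform limits (all Mathlib ∕ tree);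
no inequality of the series; not NE9; no `def`, 0 sorry.  What R2 still needs is NOT here: B2 (the map `T` of (1.13) typed on
lit-balaban's concrete carriers = socket C19′) and B3 (the two inequalities making it a self-map and a contraction at COMPLEX
data — displayed-type binders `QuadAnalytic` ∕ `‖H‖ ≤ b` of `B13Contraction113`, GAPS G-B13-02).

References (TYPES ∕ loci only, nothing asserted): [Balaban1988RG2Cluster] T. Bałaban, CMP **116** (1988) 1–22, p. 5 (1.13)–(1.14);
[Balaban1985Variational] T. Bałaban, CMP **102** (1985) 277–309, Sect. C p. 286 (53)–(55), p. 287 (analyticity remark);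
S.-N. Chow, J. K. Hale, *Methods of Bifurcation Theory* (1982) §2.2 (uniform contraction principle) [folklore].
Imports: Mathlib (`ImplicitContDiff`, `Normed.Ring.Units`, `MetricSpace.Contracting`), `Literature.Analysis.Calculus.
FixedPointSmoothDependence` (continuity of fixed-point branches), `Balaban1983to89.B13Contraction113` (Part C) ONLY; modifies nothing.
Value = a generic kernel theorem serving route R2 step B4, NOT summit progress.
-/

noncomputable section

open scoped Topology ContDiff NNReal
open Metric Set Filter Function

namespace Summit.QuantumFields.BalabanUV.T4Continuum.NE9AnalyticFixedPoint

/-! ## §1 Uniform contractions of a closed ball: a-priori bound, uniqueness, the fixed-point section -/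

section Metric

variable {Ξ : Type*} {E : Type*} [NormedAddCommGroup E]

/-- [folklore] **A-priori bound.**  If `f` is `K`-Lipschitz on `s` (`K < 1`) and `x ∈ s` is a fixed point, then for every
`y ∈ s`, `dist x y ≤ dist (f y) y ∕ (1 − K)` (triangle inequality through `f y`).  With `y` the centre of a ball this is the
printed-type range bound (*"bounded by 4C₂ε₂²"*, [II] p. 5). -/
theorem dist_le_of_fixedPt_of_lipschitzOnWith {f : E → E} {s : Set E} {K : ℝ≥0} (hK : (K : ℝ) < 1)
    (hf : LipschitzOnWith K f s) {x y : E} (hx : x ∈ s) (hy : y ∈ s) (hfix : f x = x) :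
    dist x y ≤ dist (f y) y / (1 - K) := by
  have hK1 : 0 < 1 - (K : ℝ) := by linarith
  rw [le_div_iff₀ hK1]
  have h1 : dist x y ≤ K * dist x y + dist (f y) y := by
    calc dist x y = dist (f x) y := by rw [hfix]
      _ ≤ dist (f x) (f y) + dist (f y) y := dist_triangle _ _ _
      _ ≤ K * dist x y + dist (f y) y := by
          gcongr
          exact hf.dist_le_mul _ hx _ hy
  have h2 : dist x y * (1 - K) = dist x y - K * dist x y := by ring
  rw [h2]
  linarith

/-- [folklore] **Uniqueness of the fixed point in the Lipschitz set** (`K < 1`). -/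
theorem eq_of_fixedPt_of_lipschitzOnWith {f : E → E} {s : Set E} {K : ℝ≥0} (hK : (K : ℝ) < 1)
    (hf : LipschitzOnWith K f s) {x y : E} (hx : x ∈ s) (hy : y ∈ s) (hfx : f x = x) (hfy : f y = y) :
    x = y := by
  have h := dist_le_of_fixedPt_of_lipschitzOnWith hK hf hx hy hfx
  rw [hfy, dist_self, zero_div] at h
  exact dist_le_zero.mp h

variable [CompleteSpace E]

/-- [folklore] **The fixed-point section of a family of uniform contractions of a closed ball** (Banach's theorem on the
complete subset `closedBall c r`, Mathlib `ContractingWith.exists_fixedPoint'`): for every `ξ ∈ U` let `T ξ` map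
`closedBall c r` (`0 ≤ r`) into itself and be `K`-Lipschitz there, `K < 1`; then there is `x : Ξ → E` with
`x ξ ∈ closedBall c r` and `T ξ (x ξ) = x ξ` for all `ξ ∈ U`.  (No topology on the parameter type `Ξ`.) -/
theorem exists_fixedPt_section (T : Ξ → E → E) (U : Set Ξ) {c : E} {r : ℝ} (hr : 0 ≤ r)
    {K : ℝ≥0} (hK : (K : ℝ) < 1)
    (hmaps : ∀ ξ ∈ U, MapsTo (T ξ) (closedBall c r) (closedBall c r))
    (hlip : ∀ ξ ∈ U, LipschitzOnWith K (T ξ) (closedBall c r)) :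
    ∃ x : Ξ → E, ∀ ξ ∈ U, x ξ ∈ closedBall c r ∧ T ξ (x ξ) = x ξ := by
  have hK' : K < 1 := by exact_mod_cast hK
  have h : ∀ ξ ∈ U, ∃ y, y ∈ closedBall c r ∧ T ξ y = y := by
    intro ξ hξ
    have hc : c ∈ closedBall c r := mem_closedBall_self hr
    have hcw : ContractingWith K ((hmaps ξ hξ).restrict (T ξ) (closedBall c r) (closedBall c r)) :=
      ⟨hK', (hlip ξ hξ).mapsToRestrict (hmaps ξ hξ)⟩
    obtain ⟨y, hy, hfix, -⟩ := ContractingWith.exists_fixedPoint' isClosed_closedBall.isComplete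
      (hmaps ξ hξ) hcw hc (edist_ne_top _ _)
    exact ⟨y, hy, hfix.eq⟩
  choose! x hx using h
  exact ⟨x, hx⟩

end Metric

/-! ## §2 The local step: a continuous branch of fixed points of a `Cⁿ` uniform contraction is `Cⁿ` (`𝕜 = ℝ` or `ℂ`) -/

section Local

variable {𝕜 : Type*} [RCLike 𝕜]
  {Ξ : Type*} [NormedAddCommGroup Ξ] [NormedSpace 𝕜 Ξ] [CompleteSpace Ξ]
  {E : Type*} [NormedAddCommGroup E] [NormedSpace 𝕜 E] [CompleteSpace E]

omit [CompleteSpace Ξ] [CompleteSpace E] in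
/-- [folklore] **`‖∂₂T‖ ≤ K` from a Lipschitz bound on a neighbourhood** (converse to the mean value inequality, Mathlib
`HasFDerivAt.le_of_lipschitzOn`): if `T : Ξ × E → E` is differentiable at `(p, x₀)` and `x ↦ T (p, x)` is `K`-Lipschitz on a
neighbourhood `s` of `x₀`, the partial derivative `fderiv T (p, x₀) ∘ inr` has operator norm `≤ K`. -/
theorem norm_fderiv_comp_inr_le_of_lipschitzOnWith {T : Ξ × E → E} {p : Ξ} {x₀ : E} {s : Set E} {K : ℝ≥0}
    (hT : DifferentiableAt 𝕜 T (p, x₀)) (hs : s ∈ 𝓝 x₀) (hlip : LipschitzOnWith K (fun x ↦ T (p, x)) s) :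
    ‖fderiv 𝕜 T (p, x₀) ∘L ContinuousLinearMap.inr 𝕜 Ξ E‖ ≤ K := by
  have h : HasFDerivAt (fun x ↦ T (p, x)) (fderiv 𝕜 T (p, x₀) ∘L ContinuousLinearMap.inr 𝕜 Ξ E) x₀ :=
    hT.hasFDerivAt.comp x₀ (hasFDerivAt_prodMk_right p x₀)
  exact h.le_of_lipschitzOn hs hlip

/-- [folklore] **`Cⁿ` dependence of fixed points on a Banach parameter — local form over `𝕜 = ℝ` or `ℂ`** (the `RCLike`
version of the tree's real `Literature.Analysis.Calculus.contDiffAt_fixedPoint`; Chow–Hale 1982 §2.2).  Let `T : Ξ × E → E` be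
`Cⁿ` at `(p, θ p)` (`n ≠ 0`; `n = ω` allowed), where `θ p'` is a fixed point of `T (p', ·)` for `p'` near `p`, `θ` is continuous
at `p`, and `‖∂₂T (p, θ p)‖ < 1`.  Then `θ` is `Cⁿ` at `p`: the partial derivative `1 − ∂₂T` of `Φ (p, x) := x − T (p, x)` is
invertible (Neumann series, `Units.oneSub`), the implicit function of `Φ` at `(p, θ p)` is `Cⁿ`
(`ContDiffAt.contDiffAt_implicitFunction`), and it agrees with `θ` near `p` by local uniqueness
(`ContDiffAt.eventually_apply_eq_iff_implicitFunction`) and the continuity of `θ`. -/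
theorem contDiffAt_fixedPt {T : Ξ × E → E} {θ : Ξ → E} {p : Ξ} {n : ℕ∞ω} (hn : n ≠ 0)
    (hT : ContDiffAt 𝕜 n T (p, θ p))
    (hcontr : ‖fderiv 𝕜 T (p, θ p) ∘L ContinuousLinearMap.inr 𝕜 Ξ E‖ < 1)
    (hfix : ∀ᶠ p' in 𝓝 p, T (p', θ p') = θ p') (hθ : ContinuousAt θ p) :
    ContDiffAt 𝕜 n θ p := by
  set Φ : Ξ × E → E := fun q ↦ q.2 - T q with hΦdef
  have hΦ : ContDiffAt 𝕜 n Φ (p, θ p) := contDiffAt_snd.sub hT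
  have hd : DifferentiableAt 𝕜 T (p, θ p) := (hT.hasStrictFDerivAt hn).hasFDerivAt.differentiableAt
  have hderiv : fderiv 𝕜 Φ (p, θ p) = ContinuousLinearMap.snd 𝕜 Ξ E - fderiv 𝕜 T (p, θ p) := by
    rw [show Φ = fun q ↦ Prod.snd q - T q from rfl, fderiv_fun_sub differentiableAt_snd hd, fderiv_snd]
  have hinv : (fderiv 𝕜 Φ (p, θ p) ∘L ContinuousLinearMap.inr 𝕜 Ξ E).IsInvertible := by
    rw [hderiv, ContinuousLinearMap.sub_comp, ContinuousLinearMap.snd_comp_inr]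
    refine ⟨ContinuousLinearEquiv.ofUnit
      (Units.oneSub (fderiv 𝕜 T (p, θ p) ∘L ContinuousLinearMap.inr 𝕜 Ξ E) hcontr), ?_⟩
    ext x
    rfl
  have h0 : Φ (p, θ p) = 0 := by
    simp only [hΦdef]
    rw [hfix.self_of_nhds, sub_self]
  have hzero : ∀ᶠ p' in 𝓝 p, Φ (p', θ p') = Φ (p, θ p) := by
    filter_upwards [hfix] with p' hp'
    rw [h0]
    simp only [hΦdef]
    rw [hp', sub_self]
  -- identify `θ` with the implicit function of `Φ` near `p`
  have hev := hΦ.eventually_apply_eq_iff_implicitFunction hn hinv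
  have htend : Tendsto (fun p' ↦ (p', θ p')) (𝓝 p) (𝓝 (p, θ p)) :=
    (continuous_id.continuousAt.prodMk hθ :)
  have heq : θ =ᶠ[𝓝 p] hΦ.implicitFunction hn hinv := by
    filter_upwards [htend.eventually hev, hzero] with p' h hz
    exact ((h.mp hz).symm :)
  exact (hΦ.contDiffAt_implicitFunction hn hinv).congr_of_eventuallyEq heq

end Local

/-! ## §3 The global theorem: the fixed-point section of a `Cⁿ` family of uniform contractions is `Cⁿ` on the parameter region -/

section Global

variable {𝕜 : Type*} [RCLike 𝕜]
  {Ξ : Type*} [NormedAddCommGroup Ξ] [NormedSpace 𝕜 Ξ] [CompleteSpace Ξ]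
  {E : Type*} [NormedAddCommGroup E] [NormedSpace 𝕜 E] [CompleteSpace E]

/-- [folklore] **UNIFORM CONTRACTION PRINCIPLE, `Cⁿ` ∕ ANALYTIC FORM, BANACH PARAMETER.**  Let `U ⊆ Ξ` be open, `0 ≤ r < r'`,
`K < 1`, `n ≠ 0` (`n = ω` allowed).  Suppose that for every `ξ ∈ U` the map `T ξ : E → E` sends `closedBall c r` into itself and
is `K`-Lipschitz on the open ball `ball c r' ⊇ closedBall c r`, and that `(ξ, X) ↦ T ξ X` is of class `Cⁿ` on `U ×ˢ ball c r'`.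
Then there is a fixed-point section `x : Ξ → E` with: `ContDiffOn 𝕜 n x U`; `x ξ ∈ closedBall c r` and `T ξ (x ξ) = x ξ` for
`ξ ∈ U`; UNIQUENESS — any fixed point of `T ξ` in `closedBall c r` equals `x ξ`; and the A-PRIORI BOUND
`dist (x ξ) y ≤ dist (T ξ y) y ∕ (1 − K)` for every `y ∈ closedBall c r` (at `y = c`: `‖x ξ − c‖ ≤ ‖T ξ c − c‖ ∕ (1 − K)`).
Proof: §1 gives the section; at each `ξ₀ ∈ U` it is continuous (`Literature.Analysis.Calculus.continuousAt_fixedPoint_of_lipschitz`),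
`‖∂₂T(ξ₀, x ξ₀)‖ ≤ K < 1` (`norm_fderiv_comp_inr_le_of_lipschitzOnWith`, the open ball being a neighbourhood of `x ξ₀`), and
`contDiffAt_fixedPt` applies. -/
theorem exists_contDiffOn_fixedPt_section (T : Ξ → E → E) {U : Set Ξ} (hU : IsOpen U) {c : E}
    {r r' : ℝ} (hr : 0 ≤ r) (hrr' : r < r') {K : ℝ≥0} (hK : (K : ℝ) < 1) {n : ℕ∞ω} (hn : n ≠ 0)
    (hmaps : ∀ ξ ∈ U, MapsTo (T ξ) (closedBall c r) (closedBall c r))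
    (hlip : ∀ ξ ∈ U, LipschitzOnWith K (T ξ) (ball c r'))
    (hT : ContDiffOn 𝕜 n (fun q : Ξ × E => T q.1 q.2) (U ×ˢ ball c r')) :
    ∃ x : Ξ → E, ContDiffOn 𝕜 n x U ∧ (∀ ξ ∈ U, x ξ ∈ closedBall c r ∧ T ξ (x ξ) = x ξ) ∧
      (∀ ξ ∈ U, ∀ y ∈ closedBall c r, T ξ y = y → y = x ξ) ∧
      (∀ ξ ∈ U, ∀ y ∈ closedBall c r, dist (x ξ) y ≤ dist (T ξ y) y / (1 - K)) := by
  have hsub : closedBall c r ⊆ ball c r' := closedBall_subset_ball hrr'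
  have hlip' : ∀ ξ ∈ U, LipschitzOnWith K (T ξ) (closedBall c r) := fun ξ hξ => (hlip ξ hξ).mono hsub
  obtain ⟨x, hx⟩ := exists_fixedPt_section T U hr hK hmaps hlip'
  refine ⟨x, fun ξ₀ hξ₀ => ?_, hx, fun ξ hξ y hy hfy => ?_, fun ξ hξ y hy => ?_⟩
  · -- `Cⁿ` at `ξ₀ ∈ U`
    have hx₀ : x ξ₀ ∈ ball c r' := hsub (hx ξ₀ hξ₀).1
    have hUn : U ∈ 𝓝 ξ₀ := hU.mem_nhds hξ₀
    have hprod : U ×ˢ ball c r' ∈ 𝓝 (ξ₀, x ξ₀) := prod_mem_nhds hUn (isOpen_ball.mem_nhds hx₀)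
    have hTat : ContDiffAt 𝕜 n (fun q : Ξ × E => T q.1 q.2) (ξ₀, x ξ₀) :=
      (hT _ ⟨hξ₀, hx₀⟩).contDiffAt hprod
    have hfix : ∀ᶠ ξ in 𝓝 ξ₀, (fun q : Ξ × E => T q.1 q.2) (ξ, x ξ) = x ξ := by
      filter_upwards [hUn] with ξ hξ using (hx ξ hξ).2
    have hcontT : ContinuousAt (fun ξ => (fun q : Ξ × E => T q.1 q.2) (ξ, x ξ₀)) ξ₀ :=
      ContinuousAt.comp_of_eq hTat.continuousAt (continuousAt_id.prodMk continuousAt_const) rfl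
    have hθ : ContinuousAt x ξ₀ :=
      Literature.Analysis.Calculus.continuousAt_fixedPoint_of_lipschitz (T := fun q : Ξ × E => T q.1 q.2)
        (θ := x) (B := closedBall c r) hK (hx ξ₀ hξ₀).1
        (by filter_upwards [hUn] with ξ hξ using (hx ξ hξ).1)
        (by filter_upwards [hUn] with ξ hξ using hlip' ξ hξ)
        hfix hcontT
    have hcontr : ‖fderiv 𝕜 (fun q : Ξ × E => T q.1 q.2) (ξ₀, x ξ₀) ∘L ContinuousLinearMap.inr 𝕜 Ξ E‖ < 1 :=
      (norm_fderiv_comp_inr_le_of_lipschitzOnWith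
        (hTat.hasStrictFDerivAt hn).hasFDerivAt.differentiableAt
        (isOpen_ball.mem_nhds hx₀) (hlip ξ₀ hξ₀)).trans_lt hK
    exact (contDiffAt_fixedPt (θ := x) hn hTat hcontr hfix hθ).contDiffWithinAt
  · exact eq_of_fixedPt_of_lipschitzOnWith hK (hlip' ξ hξ) hy (hx ξ hξ).1 hfy (hx ξ hξ).2
  · exact dist_le_of_fixedPt_of_lipschitzOnWith hK (hlip' ξ hξ) (hx ξ hξ).1 hy (hx ξ hξ).2

end Global

/-! ## §4 The complex-analytic forms route R2 consumes -/

section Complex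

variable {Ξ : Type*} [NormedAddCommGroup Ξ] [NormedSpace ℂ Ξ] [CompleteSpace Ξ]
  {E : Type*} [NormedAddCommGroup E] [NormedSpace ℂ E] [CompleteSpace E]

/-- [folklore] **THE FIXED POINT OF A UNIFORM CONTRACTION IS JOINTLY ANALYTIC IN A COMPLEX BANACH PARAMETER** (the form of
[II] p. 5 *"hence the fixed point is an analytic function of A′, s(Y₀), bounded by 4C₂ε₂²"* ∕ [15] p. 286 *"it is an analytic
function of A′"* with ALL parameters at once — any complex Banach parameter space `Ξ`, e.g. `(s, A′, (U, J))` jointly; the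
gap «joint analyticity … not formalised» of `B13Contraction113`'s certificate C-B13-02, closed without Osgood ∕ Hartogs).
Hypotheses as in `exists_contDiffOn_fixedPt_section` with `(ξ, X) ↦ T ξ X` analytic on `U ×ˢ ball c r'`; conclusion: the
fixed-point section is `AnalyticOnNhd ℂ` on `U`, valued in `closedBall c r`, unique there, with the a-priori bound. -/
theorem exists_analyticOnNhd_fixedPt_section (T : Ξ → E → E) {U : Set Ξ} (hU : IsOpen U) {c : E}
    {r r' : ℝ} (hr : 0 ≤ r) (hrr' : r < r') {K : ℝ≥0} (hK : (K : ℝ) < 1)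
    (hmaps : ∀ ξ ∈ U, MapsTo (T ξ) (closedBall c r) (closedBall c r))
    (hlip : ∀ ξ ∈ U, LipschitzOnWith K (T ξ) (ball c r'))
    (hT : AnalyticOnNhd ℂ (fun q : Ξ × E => T q.1 q.2) (U ×ˢ ball c r')) :
    ∃ x : Ξ → E, AnalyticOnNhd ℂ x U ∧ (∀ ξ ∈ U, x ξ ∈ closedBall c r ∧ T ξ (x ξ) = x ξ) ∧
      (∀ ξ ∈ U, ∀ y ∈ closedBall c r, T ξ y = y → y = x ξ) ∧
      (∀ ξ ∈ U, ∀ y ∈ closedBall c r, dist (x ξ) y ≤ dist (T ξ y) y / (1 - K)) := by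
  have hω : (ω : ℕ∞ω) ≠ 0 := by simp
  obtain ⟨x, hxs, h1, h2, h3⟩ := exists_contDiffOn_fixedPt_section T hU hr hrr' hK hω hmaps hlip
    (hT.contDiffOn_of_completeSpace (n := ω))
  refine ⟨x, fun ξ hξ => ?_, h1, h2, h3⟩
  exact ((hxs ξ hξ).contDiffAt (hU.mem_nhds hξ)).analyticAt

/-- [folklore] **The route sketch's ONE-VARIABLE signature** (`t4/ideate/NE9/lens1-NE9Lens1Sketch.lean`,
`NE9Lens1Sketch.exists_differentiableOn_fixedPoint`, prediction P-R2-2 of `t4/ROUTES-NE9.md` v1) — a COROLLARY of the tree's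
`B13Contraction113.differentiableOn_fixedPoint` (Part C): a family `T z`, `z ∈ U ⊆ ℂ` open, of self-maps of `closedBall 0 r`,
`K`-Lipschitz there (`K < 1`), with `(z, X) ↦ T z X` merely complex-DIFFERENTIABLE on `U ×ˢ ball 0 r'` (`r < r'`; no `Cⁿ`
hypothesis — one complex variable), has a fixed-point section holomorphic on `U`, unique in the ball, and the successive
approximations `(T z)^[n] 0` converge to it at the uniform rate `2rKⁿ ∕ (1 − K)`.  (On the open `U`, `DifferentiableOn ℂ` upgrades
to `AnalyticOnNhd ℂ` by Mathlib `DifferentiableOn.analyticOnNhd`.) -/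
theorem exists_differentiableOn_fixedPoint (T : ℂ → E → E) {U : Set ℂ} (hU : IsOpen U) {r r' : ℝ}
    (hr : 0 ≤ r) (hrr' : r < r') {K : ℝ≥0} (hK : (K : ℝ) < 1)
    (hmaps : ∀ z ∈ U, MapsTo (T z) (closedBall 0 r) (closedBall 0 r))
    (hlip : ∀ z ∈ U, LipschitzOnWith K (T z) (closedBall 0 r))
    (hdiff : DifferentiableOn ℂ (fun p : ℂ × E => T p.1 p.2) (U ×ˢ ball 0 r')) :
    ∃ x : ℂ → E, (∀ z ∈ U, x z ∈ closedBall (0 : E) r ∧ T z (x z) = x z) ∧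
      (∀ z ∈ U, ∀ y ∈ closedBall (0 : E) r, T z y = y → y = x z) ∧ DifferentiableOn ℂ x U ∧
      ∀ z ∈ U, ∀ n : ℕ, dist ((T z)^[n] 0) (x z) ≤ 2 * r * K ^ n / (1 - K) := by
  have han : ∀ g : ℂ → E, DifferentiableOn ℂ g U → MapsTo g U (closedBall (0 : E) r) →
      DifferentiableOn ℂ (fun σ => T σ (g σ)) U := by
    intro g hg hgm
    exact hdiff.comp (differentiableOn_id.prodMk hg)
      (fun σ hσ => ⟨hσ, closedBall_subset_ball hrr' (hgm hσ)⟩)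
  obtain ⟨x, hxd, hfix, hrate⟩ :=
    Literature.MathematicalPhysics.QuantumFieldTheory.Balaban1983to89.B13Contraction113.differentiableOn_fixedPoint
      hU hr K.coe_nonneg hK hmaps (fun σ hσ X hX X' hX' => (hlip σ hσ).norm_sub_le hX hX') han
  exact ⟨x, hfix, fun z hz y hy hfy =>
    eq_of_fixedPt_of_lipschitzOnWith hK (hlip z hz) hy (hfix z hz).1 hfy (hfix z hz).2, hxd, hrate⟩

end Complex

end Summit.QuantumFields.BalabanUV.T4Continuum.NE9AnalyticFixedPoint

end
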